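import Literature.AlgebraicGeometry.GroupSchemes.BarsottiTateGroupFixedPartHeight
import HarnessLib

/-!
# Crux `HLiu418` — P6 sub-line **F0-P6b BTSerreTate**, stub (L4.2) `stub_L42_idempotentSplitting` PAID

Cell `hodgecm-mathlib`, P6 «MOD programme» Row 4B, line `Cruxes/HLiu418/Lines/F0_P6b_BTSerreTate.lean` (F0P6b-plan (g0), ED. 1, tree
sha16 `2cc75baf80c6ae23`, commit 8639a5faa23d), registered stub §4 `stub_L42_idempotentSplitting` (:202–:209 of the line): «over `Spec A`,
`A` local, `p` prime, an idempotent endomorphism `ε` of a Barsotti–Tate group `B` (★ `BTGroup.Hom`) splits off a Barsotti–Tate group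
`B₁` with a homomorphism `j : B₁ → B` whose layers are closed immersions, `j.app n ≫ ε.app n = j.app n`, universal for `ε.app n`-fixed
points».  This file proves THE TEXT OF THE STUB token for token (same binders, `A : Type`, `Scheme.{0}`; nothing imports a
`Cruxes/…/Lines` module) as the theorem `stubL42IdempotentSplitting`, so that the desk folds
`stub_L42_idempotentSplitting := F0P6bStubL42.stubL42IdempotentSplitting` BY NAME at the next edition (seat F0P6-p15 (g0), σ2 «kernel of
`1 − ε` + splitting `G_n ≅ Ker ε × Ker(1 − ε)`»).  The proof is the ★ Literature organ
`Literature.AlgebraicGeometry.GroupSchemes.BTGroup.exists_btGroup_hom_of_idempotent` (`GroupSchemes/BarsottiTateGroupFixedPartHeight.lean`)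
over ★ `BarsottiTateGroupFixedPart` (the Barsotti–Tate group `Fix ε`: layers `Fix ε_n = Ker(𝟙 ∕ ε_n)` of ★ `IdempotentSplittingFiniteFlat`,
Tate's kernel square, restricted `[p]`-maps flat and surjective by a retract of `G_{n+1} ×_{G_n} Fix ε_n`, ★ `FlatOfRetract`) and ★
`Morphisms/FiniteFlatRankComp` (rank of a composite ∕ fibre product of finite flat morphisms; height `p^{n h₁}` from `rk Fix ε_1 ∣ p^h`,
`p` prime).  HC_CM is proved only modulo the printed citations until rung 0 closes; nothing here is about HC — it discharges one
registered stub of the P6b line.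

## References
* [Tate1967] J. T. Tate, *p-divisible groups*, Proc. Conf. Local Fields (Driebergen 1966), Springer 1967 — §1, §2 (2.1)–(2.2).
* [RapoportSmithlingZhang2020Diagonal] M. Rapoport, B. Smithling, W. Zhang, *Arithmetic diagonal cycles on unitary Shimura varieties*,
  Compos. Math. 156 (2020) — §4.1 (p. 17), «(dec pdiv)» `A[p^∞] = ∏_w A[w^∞]`.
* [Carayol1986Compositio] H. Carayol, *Sur la mauvaise réduction des courbes de Shimura*, Compositio Math. 59 (1986) — §1.4 (pp. 159–161).
-/

-- The cell's namespace `Summit.HodgeConjecture.HodgeConjecture.…` repeats `HodgeConjecture` (summit = sub-problem), which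
-- `linter.dupNamespace` flags; the lakefile turns the linter off tree-wide (weak option), restated here so stand-alone elaboration is
-- warning-free.
set_option linter.dupNamespace false
set_option autoImplicit false

namespace Summit.HodgeConjecture.HodgeConjecture.Cruxes.HLiu418.F0P6bStubL42

open CategoryTheory AlgebraicGeometry
open Literature.AlgebraicGeometry.GroupSchemes

/-- **Stub (L4.2) «idempotent splitting of Barsotti–Tate groups» — the text of `F0P6bBTSerreTate.stub_L42_idempotentSplitting`.**  Over
`Spec A`, `A` a LOCAL ring, `p` PRIME, for a Barsotti–Tate group `B` of height `h` and an idempotent endomorphism `ε : B → B`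
(`ε.app n ≫ ε.app n = ε.app n`): there are `h₁`, a Barsotti–Tate group `B₁` of height `h₁` and a homomorphism `j : B₁ → B` with
closed-immersion layers, `j.app n ≫ ε.app n = j.app n`, and every `T`-valued point `t` of `B.G n` with `t ≫ ε.app n = t` factors
uniquely through `j.app n`.  Proof: ★ `BTGroup.exists_btGroup_hom_of_idempotent` (`B₁ = Fix ε`, height from `rk Fix ε_1 ∣ p^h`).
[cite: Tate1967, §2 (2.1)–(2.2)] [cite: RapoportSmithlingZhang2020Diagonal, §4.1 (p. 17)] [cite: Carayol1986Compositio, §1.4 (pp. 159–161)] -/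
theorem stubL42IdempotentSplitting :
    ∀ (p : ℕ), p.Prime → ∀ (A : Type) [CommRing A] [IsLocalRing A] (h : ℕ) (B : BTGroup (Spec (.of A)) p h)
      (ε : BTGroup.Hom B B), (∀ n, ε.app n ≫ ε.app n = ε.app n) →
      ∃ (h₁ : ℕ) (B₁ : BTGroup (Spec (.of A)) p h₁) (j : BTGroup.Hom B₁ B),
        (∀ n, IsClosedImmersion (j.app n).left) ∧
          (∀ n, j.app n ≫ ε.app n = j.app n) ∧
          (∀ n ⦃T : Over (Spec (.of A))⦄ (t : T ⟶ B.G n), t ≫ ε.app n = t → ∃! s : T ⟶ B₁.G n, s ≫ j.app n = t) :=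
  fun p hp A _ _ => BTGroup.exists_btGroup_hom_of_idempotent p hp A

end Summit.HodgeConjecture.HodgeConjecture.Cruxes.HLiu418.F0P6bStubL42
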